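import Mathlib
import Summits.NavierStokesRegularity.NavierStokesRegularity.Theorems.SubOnsagerCeilingVirtualFloorWindow4Face
import HarnessLib

/-!
# Ω-coupled four-shell windows, general face family, bounded form: the UNPADDED chain interface (`Y 0 = 0`)
(helper file for crux stmt-NavierStokesRegularity-27057 `SubOnsagerCeiling.ForwardTailCeilingKP`, `--supports … --as helper`;
LEAD SOC g9, line «kp-shell-barrier»)

`window4_le_of_coupledFaceCertB` (sibling file, LEAD g9) is stated for chains with THREE identically vanishing bottom shells (so that
every live shell is the top of a full four-shell window). The rescaled Katz–Pavlović chain of the wrappers has ONE vanishing shell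
`Y 0 = 0` below the datum. This file pads two more zero shells underneath (shifting rates and dampings by `L²`, `b2²`) and restates
the lemma in the unpadded interface — verbatim the role of `window4_le_of_coupledCertB'` (p680837) for the linear-facet format,
whose proof is copied with the general face hypotheses passed through. MODEL lattice; no certificate is proved here; nothing here
bears on Navier–Stokes regularity; 27057 stays OPEN.
[cite: BarbatoMorandinRomito2011, §2 Lemma 2.1]
-/

noncomputable section

-- the sub-problem namespace `NavierStokesRegularity.NavierStokesRegularity` is the tree's layout (D-0017)
set_option linter.dupNamespace false

namespace Summit.NavierStokesRegularity.NavierStokesRegularity.Theorems.VirtualFloor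

open Set Filter Topology

set_option maxHeartbeats 400000 in
/-- **Ω-coupled four-shell windows with a general face family, bounded form, unpadded interface** (`Y 0 = 0`, live shells
`n ≥ 1`, quiescent tail from `K` on): under the hypotheses of `window4_le_of_coupledFaceCertB` on the face family, every shell
is `≤ c`. [cite: BarbatoMorandinRomito2011, §2 Lemma 2.1] -/
theorem window4_le_of_coupledFaceCertB' {ι : Type*} [Finite ι] {Y : ℕ → ℝ → ℝ} {κ F : ℕ → ℝ}
    {L p s δ₀ b2 c : ℝ} {K : ℕ} {g : ι → (Fin 4 → ℝ) → ℝ} {dg : ι → Fin 4 → (Fin 4 → ℝ) → ℝ}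
    (hs : 0 < s) (hκ : ∀ n, 0 ≤ κ n) (hκg : ∀ n, κ (n + 1) = b2 * κ n) (hb2 : 0 < b2) (hF : ∀ n, 0 < F n)
    (hFL : ∀ n, F (n + 1) = L * F n)
    (hcontg : ∀ k, Continuous (g k))
    (hchain : ∀ k (X : ℝ → Fin 4 → ℝ) (X' : Fin 4 → ℝ) (S : Set ℝ) (t : ℝ),
      (∀ i, HasDerivWithinAt (fun r => X r i) (X' i) S t) →
      HasDerivWithinAt (fun r => g k (X r)) (∑ i, dg k i (X t) * X' i) S t)
    (hInit : ∀ x : Fin 4 → ℝ, (∀ i, 0 ≤ x i) → (∀ i, x i ≤ δ₀) → ∀ k, g k x ≤ 0)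
    (hSafe : ∀ x : Fin 4 → ℝ, (∀ i, 0 ≤ x i) → (∀ k, g k x ≤ 0) → x 3 ≤ c)
    (hFace : ∀ k (x : Fin 4 → ℝ) (v z : ℝ), (∀ i, 0 ≤ x i) → 0 ≤ v → 0 ≤ z → (∀ i, x i ≤ c) → v ≤ c → z ≤ c →
      (∀ k', g k' x ≤ 0) → (∀ k', g k' (vec4 v (x 0) (x 1) (x 2)) ≤ 0) → (∀ k', g k' (vec4 (x 1) (x 2) (x 3) z) ≤ 0) →
      g k x = 0 →
      (dg k 0 x * (v ^ 2 - p * x 0 * x 1) + dg k 1 x * (L * (x 0 ^ 2 - p * x 1 * x 2)) +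
          dg k 2 x * (L ^ 2 * (x 1 ^ 2 - p * x 2 * x 3)) + dg k 3 x * (L ^ 3 * (x 2 ^ 2 - p * x 3 * z)) < 0) ∧
      0 ≤ dg k 0 x * x 0 + dg k 1 x * (b2 * x 1) + dg k 2 x * (b2 ^ 2 * x 2) + dg k 3 x * (b2 ^ 3 * x 3))
    (hY0 : ∀ t, Y 0 t = 0)
    (hcont : ∀ n, ContinuousOn (Y n) (Icc 0 s))
    (hderiv : ∀ n, 1 ≤ n → ∀ t ∈ Ico 0 s, HasDerivWithinAt (Y n)
      (-κ n * Y n t + F n * (Y (n - 1) t ^ 2 - p * Y n t * Y (n + 1) t)) (Ici t) t)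
    (hpos : ∀ n, ∀ t ∈ Icc 0 s, 0 ≤ Y n t)
    (hinit : ∀ n, Y n 0 ≤ δ₀)
    (htail : ∀ n, K ≤ n → ∀ t ∈ Icc 0 s, Y n t ≤ δ₀) :
    ∀ n, ∀ t ∈ Icc 0 s, Y n t ≤ c := by
  have hL : 0 < L := by
    have h1 : 0 < L * F 0 := (hFL 0) ▸ hF 1
    exact pos_of_mul_pos_left h1 (hF 0).le
  have hδ0 : 0 ≤ δ₀ := (hY0 0).symm.le.trans (hinit 0)
  -- the padded chain (two further zero shells below)
  set Y' : ℕ → ℝ → ℝ := fun n t => if n ≤ 2 then 0 else Y (n - 2) t with hY'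
  set κ' : ℕ → ℝ := fun n => κ 0 * b2 ^ n / b2 ^ 2 with hκ'
  set F' : ℕ → ℝ := fun n => F 0 * L ^ n / L ^ 2 with hF'
  have hbk : 0 < b2 ^ 2 := pow_pos hb2 2
  have hLk : 0 < L ^ 2 := pow_pos hL 2
  have hκsh : ∀ j, κ (0 + j) = κ 0 * b2 ^ j := rate_shift hκg 0
  have hFsh : ∀ j, F (0 + j) = F 0 * L ^ j := rate_shift hFL 0
  have hκ'eq : ∀ j, κ' (2 + j) = κ j := by
    intro j; simp only [hκ']; rw [pow_add, ← zero_add j, hκsh j, zero_add]; field_simp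
  have hF'eq : ∀ j, F' (2 + j) = F j := by
    intro j; simp only [hF']; rw [pow_add, ← zero_add j, hFsh j, zero_add]; field_simp
  have hY'lo : ∀ n, n ≤ 2 → ∀ t, Y' n t = 0 := by intro n hn t; simp [hY', hn]
  have hY'hi : ∀ j t, Y' (2 + j) t = Y j t := by
    intro j t; rcases Nat.eq_zero_or_pos j with rfl | hj
    · simp [hY', hY0]
    · simp only [hY']; rw [if_neg (by omega)]; congr 1; omega
  have hmain := window4_le_of_coupledFaceCertB (Y := Y') (κ := κ') (F := F') (K := K + 2) (c := c) hs
    (fun n => by simp only [hκ']; exact div_nonneg (mul_nonneg (hκ 0) (pow_nonneg hb2.le n)) hbk.le)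
    (fun n => by simp only [hκ']; rw [pow_succ]; field_simp)
    (fun n => by simp only [hF']; exact div_pos (mul_pos (hF 0) (pow_pos hL n)) hLk)
    (fun n => by simp only [hF']; rw [pow_succ]; field_simp) hcontg hchain hInit hSafe hFace hY'lo ?_ ?_ ?_ ?_ ?_
  · intro n t ht
    have := hmain (2 + n) t ht
    rwa [hY'hi] at this
  · intro n
    by_cases hn : n ≤ 2
    · have : Y' n = fun _ => 0 := funext (hY'lo n hn)
      rw [this]; exact continuousOn_const
    · obtain ⟨j, rfl⟩ : ∃ j, n = 2 + j := ⟨n - 2, by omega⟩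
      have : Y' (2 + j) = Y j := funext (hY'hi j)
      rw [this]; exact hcont j
  · intro n hn t ht
    by_cases hnk : n ≤ 2
    · have h0 : Y' n = fun _ => 0 := funext (hY'lo n hnk)
      have h1 : Y' (n - 1) t = 0 := hY'lo (n - 1) (by omega) t
      rw [h0]
      have : -κ' n * (0 : ℝ) + F' n * (Y' (n - 1) t ^ 2 - p * 0 * Y' (n + 1) t) = 0 := by rw [h1]; ring
      rw [this]
      exact hasDerivWithinAt_const t (Ici t) 0
    · obtain ⟨j, rfl⟩ : ∃ j, n = 2 + j := ⟨n - 2, by omega⟩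
      have hj : 1 ≤ j := by omega
      have h := hderiv j hj t ht
      have e0 : Y' (2 + j) = Y j := funext (hY'hi j)
      have e1 : Y' (2 + j - 1) t = Y (j - 1) t := by
        rw [show 2 + j - 1 = 2 + (j - 1) by omega]; exact hY'hi (j - 1) t
      have e2 : Y' (2 + j + 1) t = Y (j + 1) t := by
        rw [show 2 + j + 1 = 2 + (j + 1) by omega]; exact hY'hi (j + 1) t
      rw [e0, e1, e2, hκ'eq, hF'eq]
      exact h
  · intro n t ht
    by_cases hn : n ≤ 2
    · rw [hY'lo n hn]
    · obtain ⟨j, rfl⟩ : ∃ j, n = 2 + j := ⟨n - 2, by omega⟩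
      rw [hY'hi]; exact hpos j t ht
  · intro n
    by_cases hn : n ≤ 2
    · rw [hY'lo n hn]; exact hδ0
    · obtain ⟨j, rfl⟩ : ∃ j, n = 2 + j := ⟨n - 2, by omega⟩
      rw [hY'hi]; exact hinit j
  · intro n hn t ht
    obtain ⟨j, rfl⟩ : ∃ j, n = 2 + j := ⟨n - 2, by omega⟩
    rw [hY'hi]; exact htail j (by omega) t ht

end Summit.NavierStokesRegularity.NavierStokesRegularity.Theorems.VirtualFloor

end
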